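import Mathlib
import Summits.MatrixMultiplication.Statement
import Summits.MatrixMultiplication.MatrixMultiplication.Theorems.GraphEquationsServeEngine

/-!
# Graph equations — THE DEFLATION TOWER, II: twist cancellation = the rank reading (M22b, decomp-mm-lens-5 g35)

(supports `MultiplicityReduction`, stmt-MatrixMultiplication-27806; extends the serve engine
`GraphEquationsServeEngine` (M20b).  No new definition.)

**Lemma 6(v) of the tower (NODE-g35) as a coefficient identity.**  After the tower has made the
deflated system `τ_o(a,b,c,Λ)` (`Λ` = the kernel VARIABLES of all stages) regular at the deflated
generic point, one reads the rank as follows (base translated to `0`, kernel values translated to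
`0`, the affine 1-jet of the kernel section sheared into `Λ`, all cost-free):

* the kernel section is `Λ = Q(a,b) + O(3)` with `Q` purely quadratic, and every `τ_o` vanishes along
  the 2-jet of the graph-and-kernel section `c := ab, Λ := Q` in the `a⊗b` block (`hsec`);
* REGULARITY in `(c, Λ)` supplies constants `P` with `P·[∂_c τ | ∂_Λ τ](0) = [I | 0]` (`hPc`, `hPΛ`).

THEN the served outputs `τ̃_o := τ_o(a,b,c,0)` satisfy `Σ_o P_{qo} τ̃_o = f_q + r_q` with `r_q` free of
`a⊗b` monomials (`coeff_ab_sum_killKernel_eq`), which is `hserve` of `tensorRank_le_of_abServed`; so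
`R(⟨n,n,n⟩) ≤ 2N'` whenever the `τ̃_o` are free over a nonscalar sequence of length `N'`
(`tensorRank_le_of_jetServed`).  The `Λ`-COLUMNS (`hPΛ`) are exactly what kills the TWIST
`Σ_i (Σ_o P_{qo} ∂_{Λ_i}τ_o(0))·coeff_{ab}(Q_i)` — the second-order term of the kernel section that
leaks into the `a⊗b` block when the kernel field is substituted before deflating again (the failure
mode of the substituted-field engines at gap `2`, NODE-g35 §3 control `Tuvx`).

Engine room (general, reusable): for a substitution `f` whose values have no constant term,
`coeff_0 (t∘f) = coeff_0 t` (`coeff_zero_bind₁_of_coeff_zero`), the LINEAR coefficients of `t∘f` are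
`Σ_v coeff_v(t)·coeff(f v)` (`coeff_single_bind₁`), and for a PROBE-LIKE `f` (only `f a` has an
`x`-linear term, only `f b` a `y`-linear term) the BILINEAR coefficient is
`coeff_{xy}(t∘f) = coeff_{ab}(t) + Σ_v coeff_v(t)·coeff_{xy}(f v)` (`coeff_single_add_single_bind₁`) —
the many-variable form of `coeff_ab_graphRestrict` (M19b).  No `sorry`.
Sources: NODE-g35 §2 Lemma 6; Leykin–Verschelde–Zhao, Theoret. Comput. Sci. 359 (2006), Thm. 3.1;
Bürgisser–Clausen–Shokrollahi (1997) (14.8), Prop. 15.1.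
-/

set_option linter.dupNamespace false

namespace Summit.MatrixMultiplication.MatrixMultiplication.Theorems.GraphEquations

open MvPolynomial
open Literature.Computability.AlgebraicComplexity
open Literature.Computability.AlgebraicComplexity.ArithCircuit

/-! ## Coefficients of degree `≤ 2` after a substitution without constant terms -/

section Subst

variable {σ κ R : Type*} [CommSemiring R]

/-- `coeff_0 (t ∘ f) = coeff_0 t` when no `f v` has a constant term. -/
theorem coeff_zero_bind₁_of_coeff_zero (f : σ → MvPolynomial κ R) (hf0 : ∀ v, coeff 0 (f v) = 0)
    (t : MvPolynomial σ R) : coeff 0 (bind₁ f t) = coeff 0 t := by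
  induction t using MvPolynomial.induction_on with
  | C a => rw [bind₁_C_right, coeff_zero_C, coeff_zero_C]
  | add p q hp hq => rw [map_add, coeff_add, coeff_add, hp, hq]
  | mul_X p v hp =>
    rw [map_mul, bind₁_X_right, coeff_zero_mul_eq, coeff_zero_mul_eq, hf0, coeff_zero_X, mul_zero,
      mul_zero]

/-- The coefficient of `x_w` in `X v` is `[w = v]`. -/
theorem coeff_single_X_eq [DecidableEq σ] (w v : σ) :
    coeff (Finsupp.single w 1) (X v : MvPolynomial σ R) = if w = v then 1 else 0 := by
  rw [coeff_X]
  by_cases h : w = v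
  · subst h; simp
  · rw [if_neg, if_neg h]
    intro h'
    exact h ((Finsupp.single_left_inj (one_ne_zero)).mp h').symm

/-- **LINEAR coefficients after substitution:** `coeff_x (t ∘ f) = Σ_v coeff_v(t)·coeff_x(f v)`. -/
theorem coeff_single_bind₁ [Fintype σ] [DecidableEq σ] (f : σ → MvPolynomial κ R)
    (hf0 : ∀ v, coeff 0 (f v) = 0) (x : κ) (t : MvPolynomial σ R) :
    coeff (Finsupp.single x 1) (bind₁ f t) =
      ∑ v, coeff (Finsupp.single v 1) t * coeff (Finsupp.single x 1) (f v) := by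
  classical
  induction t using MvPolynomial.induction_on with
  | C a =>
    have h1 : (0 : κ →₀ ℕ) ≠ Finsupp.single x 1 := (Finsupp.single_ne_zero.mpr one_ne_zero).symm
    have h2 : ∀ v : σ, (0 : σ →₀ ℕ) ≠ Finsupp.single v 1 :=
      fun v => (Finsupp.single_ne_zero.mpr one_ne_zero).symm
    rw [bind₁_C_right, coeff_C, if_neg h1]
    refine (Finset.sum_eq_zero fun v _ => ?_).symm
    rw [coeff_C, if_neg (h2 v), zero_mul]
  | add p q hp hq =>
    rw [map_add, coeff_add, hp, hq, ← Finset.sum_add_distrib]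
    exact Finset.sum_congr rfl fun v _ => by rw [coeff_add, add_mul]
  | mul_X p v hp =>
    have hw : ∀ w, coeff (Finsupp.single w 1) (p * X v) = if w = v then coeff 0 p else 0 := by
      intro w
      rw [coeff_single_one_mul, coeff_zero_X, mul_zero, add_zero, coeff_single_X_eq]
      split_ifs <;> simp
    rw [map_mul, bind₁_X_right, coeff_single_one_mul, coeff_zero_bind₁_of_coeff_zero f hf0, hf0,
      mul_zero, add_zero]
    simp_rw [hw, ite_mul, zero_mul, Finset.sum_ite_eq', Finset.mem_univ, if_true]

/-- **BILINEAR coefficients after a PROBE-LIKE substitution.**  If no `f v` has a constant term,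
only `f a` has an `x`-linear term (coefficient `1`) and only `f b` a `y`-linear term, then
`coeff_{xy}(t ∘ f) = coeff_{ab}(t) + Σ_v coeff_v(t)·coeff_{xy}(f v)`. -/
theorem coeff_single_add_single_bind₁ [Fintype σ] [DecidableEq σ] (f : σ → MvPolynomial κ R)
    (hf0 : ∀ v, coeff 0 (f v) = 0) {x y : κ} (hxy : x ≠ y) {a b : σ} (hab : a ≠ b)
    (hx : ∀ v, coeff (Finsupp.single x 1) (f v) = if v = a then 1 else 0)
    (hy : ∀ v, coeff (Finsupp.single y 1) (f v) = if v = b then 1 else 0)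
    (t : MvPolynomial σ R) :
    coeff (Finsupp.single x 1 + Finsupp.single y 1) (bind₁ f t) =
      coeff (Finsupp.single a 1 + Finsupp.single b 1) t +
        ∑ v, coeff (Finsupp.single v 1) t * coeff (Finsupp.single x 1 + Finsupp.single y 1) (f v) := by
  classical
  have hxa : ∀ p : MvPolynomial σ R, coeff (Finsupp.single x 1) (bind₁ f p) =
      coeff (Finsupp.single a 1) p := by
    intro p
    rw [coeff_single_bind₁ f hf0]
    simp only [hx, mul_ite, mul_one, mul_zero, Finset.sum_ite_eq', Finset.mem_univ, if_true]
  have hyb : ∀ p : MvPolynomial σ R, coeff (Finsupp.single y 1) (bind₁ f p) =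
      coeff (Finsupp.single b 1) p := by
    intro p
    rw [coeff_single_bind₁ f hf0]
    simp only [hy, mul_ite, mul_one, mul_zero, Finset.sum_ite_eq', Finset.mem_univ, if_true]
  have hne0 : (0 : κ →₀ ℕ) ≠ Finsupp.single x 1 + Finsupp.single y 1 := by
    intro h
    have := DFunLike.congr_fun h x
    simp [hxy.symm] at this
  have hne0' : (0 : σ →₀ ℕ) ≠ Finsupp.single a 1 + Finsupp.single b 1 := by
    intro h
    have := DFunLike.congr_fun h a
    simp [hab.symm] at this
  have hXab : ∀ v : σ, coeff (Finsupp.single a 1 + Finsupp.single b 1) (X v : MvPolynomial σ R) = 0 := by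
    intro v
    rw [coeff_X, if_neg]
    intro h
    have hdeg := congrArg (fun d : σ →₀ ℕ => d a + d b) h
    simp only [Finsupp.single_apply, Finsupp.coe_add, Pi.add_apply, if_true, Ne.symm hab, hab,
      if_false, add_zero, zero_add] at hdeg
    by_cases hva : v = a
    · subst hva; simp [hab] at hdeg
    · by_cases hvb : v = b
      · subst hvb; simp [hva] at hdeg
      · simp [hva, hvb] at hdeg
  induction t using MvPolynomial.induction_on with
  | C c =>
    have h2 : ∀ v : σ, (0 : σ →₀ ℕ) ≠ Finsupp.single v 1 :=
      fun v => (Finsupp.single_ne_zero.mpr one_ne_zero).symm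
    rw [bind₁_C_right, coeff_C, if_neg hne0, coeff_C, if_neg hne0', zero_add]
    refine (Finset.sum_eq_zero fun v _ => ?_).symm
    rw [coeff_C, if_neg (h2 v), zero_mul]
  | add p q hp hq =>
    rw [map_add, coeff_add, hp, hq, coeff_add, add_add_add_comm, ← Finset.sum_add_distrib]
    congr 1
    exact Finset.sum_congr rfl fun v _ => by rw [coeff_add, add_mul]
  | mul_X p v hp =>
    have hw : ∀ w, coeff (Finsupp.single w 1) (p * X v) = if w = v then coeff 0 p else 0 := by
      intro w
      rw [coeff_single_one_mul, coeff_zero_X, mul_zero, add_zero, coeff_single_X_eq]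
      split_ifs <;> simp
    have hab2 : coeff (Finsupp.single a 1 + Finsupp.single b 1) (p * X v) =
        (if v = b then coeff (Finsupp.single a 1) p else 0) +
          (if v = a then coeff (Finsupp.single b 1) p else 0) := by
      rw [coeff_single_add_single_mul hab, hXab, coeff_zero_X, mul_zero, mul_zero, zero_add, add_zero,
        coeff_single_X_eq, coeff_single_X_eq]
      by_cases h1 : v = b
      · subst h1
        simp [hab, Ne.symm hab]
      · by_cases h2 : v = a
        · subst h2
          simp [h1, Ne.symm h1]
        · simp [h1, h2, Ne.symm h1, Ne.symm h2]
    rw [map_mul, bind₁_X_right, coeff_single_add_single_mul hxy, coeff_zero_bind₁_of_coeff_zero f hf0,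
      hxa, hyb, hx, hy, hf0, mul_zero, add_zero, hab2]
    simp_rw [hw, ite_mul, zero_mul, Finset.sum_ite_eq', Finset.mem_univ, if_true]
    split_ifs <;> ring

end Subst

variable {n : ℕ}

/-! ## The two substitutions of the rank reading -/

/-- `coeff_{a_ij b_j'l}` of `res (X v)`: `[j = j'][v = c_il]`. -/
theorem coeff_ab_graphRestrict_X (i j j' l : Fin n) (v : GraphVars n) :
    coeff (Finsupp.single (Sum.inl (i, j) : MatMulVars n) 1 +
        Finsupp.single (Sum.inr (j', l) : MatMulVars n) 1) (graphRestrict n (X v)) =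
      if j = j' then (if v = Sum.inr (i, l) then (1 : ℂ) else 0) else 0 := by
  classical
  rw [coeff_ab_graphRestrict, coeff_X, coeff_X, if_neg]
  · by_cases hjj : j = j'
    · rw [if_pos hjj, if_pos hjj, zero_add]
      by_cases hv : v = Sum.inr (i, l)
      · subst hv; simp
      · rw [if_neg hv, if_neg]
        intro h
        exact hv ((Finsupp.single_left_inj one_ne_zero).mp h)
    · rw [if_neg hjj, if_neg hjj, add_zero]
  · intro h
    have h1 := DFunLike.congr_fun h (Sum.inl (Sum.inl (i, j)))
    have h2 := DFunLike.congr_fun h (Sum.inl (Sum.inr (j', l)))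
    simp only [Finsupp.single_apply, Finsupp.coe_add, Pi.add_apply] at h1 h2
    by_cases hv : v = Sum.inl (Sum.inl (i, j))
    · subst hv; simp at h2
    · rw [if_neg hv] at h1; simp at h1

/-- Linear coefficients of `res (X v)`: `coeff_{x_w}(res (X v)) = [v = w]` (`w` an `a`/`b` variable). -/
theorem coeff_single_graphRestrict_X (w : MatMulVars n) (v : GraphVars n) :
    coeff (Finsupp.single w 1) (graphRestrict n (X v)) =
      if v = Sum.inl w then (1 : ℂ) else 0 := by
  classical
  rcases v with v | q
  · rw [graphRestrict_X_inl, coeff_single_X_eq]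
    by_cases h : w = v
    · subst h; simp
    · rw [if_neg h, if_neg]; intro h'; exact h (Sum.inl_injective h').symm
  · rw [graphRestrict_X_inr, coeff_sum, if_neg Sum.inr_ne_inl]
    refine Finset.sum_eq_zero fun k _ => ?_
    rw [coeff_single_one_mul, coeff_zero_X, coeff_zero_X, zero_mul, mul_zero, add_zero]

/-- `res (X v)` has no constant term. -/
theorem coeff_zero_graphRestrict_X (v : GraphVars n) :
    coeff 0 (graphRestrict n (X v)) = (0 : ℂ) := by
  classical
  rcases v with v | q
  · rw [graphRestrict_X_inl, coeff_zero_X]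
  · rw [graphRestrict_X_inr, coeff_sum]
    exact Finset.sum_eq_zero fun k _ => by rw [coeff_zero_mul_eq, coeff_zero_X, zero_mul]

/-! ## Twist cancellation -/

section Twist

variable {ι ο : Type*} [Fintype ι] [DecidableEq ι] [Fintype ο] [DecidableEq ο]

/-- **THE `a⊗b` BLOCK OF A DEFLATED OUTPUT ALONG THE 2-JET SECTION** (many-variable
`coeff_ab_graphRestrict`): substituting `c := ab`, `Λ_i := Q_i` (no constant, no linear terms) into
`τ ∈ ℂ[a,b,c,Λ]`,
`coeff_{a_ij b_j'l}(τ(a,b,ab,Q)) = coeff_{a_ij b_j'l}(τ) + [j=j']·coeff_{c_il}(τ) + Σ_i coeff_{Λ_i}(τ)·coeff_{a_ij b_j'l}(Q_i)`. -/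
theorem coeff_ab_bind₁_section (Q : ι → MvPolynomial (MatMulVars n) ℂ)
    (hQ0 : ∀ i, coeff 0 (Q i) = 0) (hQ1 : ∀ i (w : MatMulVars n), coeff (Finsupp.single w 1) (Q i) = 0)
    (τ : MvPolynomial (GraphVars n ⊕ ι) ℂ) (i j j' l : Fin n) :
    coeff (Finsupp.single (Sum.inl (i, j) : MatMulVars n) 1 +
        Finsupp.single (Sum.inr (j', l) : MatMulVars n) 1)
        (bind₁ (Sum.elim (fun v => graphRestrict n (X v)) Q) τ) =
      coeff (Finsupp.single (Sum.inl (Sum.inl (Sum.inl (i, j))) : GraphVars n ⊕ ι) 1 +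
          Finsupp.single (Sum.inl (Sum.inl (Sum.inr (j', l))) : GraphVars n ⊕ ι) 1) τ +
        (if j = j' then coeff (Finsupp.single (Sum.inl (Sum.inr (i, l)) : GraphVars n ⊕ ι) 1) τ
          else 0) +
        ∑ i', coeff (Finsupp.single (Sum.inr i' : GraphVars n ⊕ ι) 1) τ *
          coeff (Finsupp.single (Sum.inl (i, j) : MatMulVars n) 1 +
            Finsupp.single (Sum.inr (j', l) : MatMulVars n) 1) (Q i') := by
  classical
  have hab : (Sum.inl (i, j) : MatMulVars n) ≠ Sum.inr (j', l) := Sum.inl_ne_inr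
  have hAB : (Sum.inl (Sum.inl (Sum.inl (i, j))) : GraphVars n ⊕ ι) ≠
      Sum.inl (Sum.inl (Sum.inr (j', l))) := by simp
  rw [coeff_single_add_single_bind₁ (Sum.elim (fun v => graphRestrict n (X v)) Q) ?_ hab hAB ?_ ?_ τ]
  · -- split the sum over `GraphVars n ⊕ ι`
    rw [Fintype.sum_sum_type, add_assoc]
    congr 1
    simp only [Sum.elim_inl, Sum.elim_inr, coeff_ab_graphRestrict_X]
    congr 1
    by_cases hjj : j = j'
    · simp only [hjj, if_true, mul_ite, mul_one, mul_zero]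
      rw [Finset.sum_ite_eq' Finset.univ (Sum.inr (i, l) : GraphVars n)]
      simp
    · simp [hjj]
  · intro v; rcases v with v | i'
    · exact coeff_zero_graphRestrict_X v
    · exact hQ0 i'
  · intro v; rcases v with v | i'
    · simp only [Sum.elim_inl, coeff_single_graphRestrict_X, Sum.inl.injEq]
    · simp only [Sum.elim_inr, hQ1, reduceCtorEq, if_false]
  · intro v; rcases v with v | i'
    · simp only [Sum.elim_inl, coeff_single_graphRestrict_X, Sum.inl.injEq]
    · simp only [Sum.elim_inr, hQ1, reduceCtorEq, if_false]

/-- **THE `a⊗b` BLOCK OF A SERVED OUTPUT**: killing the kernel variables (`Λ := 0`, `c := c`) does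
not touch the `a⊗b` coefficients. -/
theorem coeff_ab_bind₁_killKernel (τ : MvPolynomial (GraphVars n ⊕ ι) ℂ) (i j j' l : Fin n) :
    coeff (Finsupp.single (Sum.inl (Sum.inl (i, j)) : GraphVars n) 1 +
        Finsupp.single (Sum.inl (Sum.inr (j', l)) : GraphVars n) 1)
        (bind₁ (Sum.elim X (fun _ => 0) : GraphVars n ⊕ ι → MvPolynomial (GraphVars n) ℂ) τ) =
      coeff (Finsupp.single (Sum.inl (Sum.inl (Sum.inl (i, j))) : GraphVars n ⊕ ι) 1 +
          Finsupp.single (Sum.inl (Sum.inl (Sum.inr (j', l))) : GraphVars n ⊕ ι) 1) τ := by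
  classical
  have hab : (Sum.inl (Sum.inl (i, j)) : GraphVars n) ≠ Sum.inl (Sum.inr (j', l)) := by simp
  have hAB : (Sum.inl (Sum.inl (Sum.inl (i, j))) : GraphVars n ⊕ ι) ≠
      Sum.inl (Sum.inl (Sum.inr (j', l))) := by simp
  rw [coeff_single_add_single_bind₁ (Sum.elim X (fun _ => 0)) ?_ hab hAB ?_ ?_ τ]
  · rw [add_eq_left]
    refine Finset.sum_eq_zero fun v _ => ?_
    rcases v with v | i'
    · rw [Sum.elim_inl, coeff_X, if_neg, mul_zero]
      intro h
      have h1 := DFunLike.congr_fun h (Sum.inl (Sum.inl (i, j)))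
      have h2 := DFunLike.congr_fun h (Sum.inl (Sum.inr (j', l)))
      simp only [Finsupp.single_apply, Finsupp.coe_add, Pi.add_apply] at h1 h2
      by_cases hv : v = Sum.inl (Sum.inl (i, j))
      · subst hv; simp at h2
      · rw [if_neg hv] at h1; simp at h1
    · simp
  · intro v; rcases v with v | i' <;> simp [coeff_zero_X]
  · intro v; rcases v with v | i'
    · simp only [Sum.elim_inl, coeff_single_X_eq, Sum.inl.injEq]
      by_cases h : Sum.inl (Sum.inl (i, j)) = v
      · subst h; simp
      · rw [if_neg h, if_neg (fun h' => h h'.symm)]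
    · simp
  · intro v; rcases v with v | i'
    · simp only [Sum.elim_inl, coeff_single_X_eq, Sum.inl.injEq]
      by_cases h : Sum.inl (Sum.inr (j', l)) = v
      · subst h; simp
      · rw [if_neg h, if_neg (fun h' => h h'.symm)]
    · simp

omit [DecidableEq ο] in
/-- **TWIST CANCELLATION (Lemma 6(v) of the tower).**  Outputs `τ_o ∈ ℂ[a,b,c,Λ]`; a purely
quadratic kernel 2-jet `Q`; every `τ_o` has vanishing `a⊗b` block along the section `c := ab, Λ := Q`
(`hsec`); constants `P` with `P·∂_c τ(0) = I` (`hPc`) and `P·∂_Λ τ(0) = 0` (`hPΛ`, the Λ-columns).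
THEN the `a⊗b` block of `Σ_o P_{qo}·τ_o(a,b,c,0)` is that of the generator `f_q`. -/
theorem coeff_ab_sum_killKernel_eq (τ : ο → MvPolynomial (GraphVars n ⊕ ι) ℂ)
    (Q : ι → MvPolynomial (MatMulVars n) ℂ) (hQ0 : ∀ i, coeff 0 (Q i) = 0)
    (hQ1 : ∀ i (w : MatMulVars n), coeff (Finsupp.single w 1) (Q i) = 0)
    (hsec : ∀ o (i j j' l : Fin n),
      coeff (Finsupp.single (Sum.inl (i, j) : MatMulVars n) 1 +
          Finsupp.single (Sum.inr (j', l) : MatMulVars n) 1)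
        (bind₁ (Sum.elim (fun v => graphRestrict n (X v)) Q) (τ o)) = 0)
    (P : Fin n × Fin n → ο → ℂ)
    (hPc : ∀ q q' : Fin n × Fin n,
      ∑ o, P q o * coeff (Finsupp.single (Sum.inl (Sum.inr q') : GraphVars n ⊕ ι) 1) (τ o) =
        if q = q' then 1 else 0)
    (hPΛ : ∀ (q : Fin n × Fin n) (i' : ι),
      ∑ o, P q o * coeff (Finsupp.single (Sum.inr i' : GraphVars n ⊕ ι) 1) (τ o) = 0)
    (q : Fin n × Fin n) (i j j' l : Fin n) :
    coeff (Finsupp.single (Sum.inl (Sum.inl (i, j)) : GraphVars n) 1 +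
        Finsupp.single (Sum.inl (Sum.inr (j', l)) : GraphVars n) 1)
        (∑ o, C (P q o) *
          bind₁ (Sum.elim X (fun _ => 0) : GraphVars n ⊕ ι → MvPolynomial (GraphVars n) ℂ) (τ o)) =
      coeff (Finsupp.single (Sum.inl (Sum.inl (i, j)) : GraphVars n) 1 +
        Finsupp.single (Sum.inl (Sum.inr (j', l)) : GraphVars n) 1) (generator n q) := by
  classical
  -- the `a⊗b` block of each `τ_o` in terms of its linear `c`/`Λ` coefficients
  have hτ : ∀ o, coeff (Finsupp.single (Sum.inl (Sum.inl (Sum.inl (i, j))) : GraphVars n ⊕ ι) 1 +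
        Finsupp.single (Sum.inl (Sum.inl (Sum.inr (j', l))) : GraphVars n ⊕ ι) 1) (τ o) =
      -((if j = j' then coeff (Finsupp.single (Sum.inl (Sum.inr (i, l)) : GraphVars n ⊕ ι) 1) (τ o)
          else 0) +
        ∑ i', coeff (Finsupp.single (Sum.inr i' : GraphVars n ⊕ ι) 1) (τ o) *
          coeff (Finsupp.single (Sum.inl (i, j) : MatMulVars n) 1 +
            Finsupp.single (Sum.inr (j', l) : MatMulVars n) 1) (Q i')) := by
    intro o
    have h := hsec o i j j' l
    rw [coeff_ab_bind₁_section Q hQ0 hQ1 (τ o) i j j' l, add_assoc] at h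
    exact eq_neg_of_add_eq_zero_left h
  simp only [coeff_sum, coeff_C_mul, coeff_ab_bind₁_killKernel, hτ, mul_neg, mul_add,
    Finset.sum_neg_distrib, Finset.sum_add_distrib, coeff_ab_generator]
  -- the `c`-column gives the generator, the `Λ`-columns kill the twist
  have hΛ : ∑ o, P q o * ∑ i', coeff (Finsupp.single (Sum.inr i' : GraphVars n ⊕ ι) 1) (τ o) *
      coeff (Finsupp.single (Sum.inl (i, j) : MatMulVars n) 1 +
        Finsupp.single (Sum.inr (j', l) : MatMulVars n) 1) (Q i') = 0 := by
    simp_rw [Finset.mul_sum, ← mul_assoc]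
    rw [Finset.sum_comm]
    refine Finset.sum_eq_zero fun i' _ => ?_
    rw [← Finset.sum_mul, hPΛ q i', zero_mul]
  rw [hΛ, add_zero]
  by_cases hjj : j = j'
  · simp only [hjj, if_true, hPc q (i, l)]
  · simp [hjj]

/-- **THE RANK READING OF THE TOWER.**  Under the hypotheses of `coeff_ab_sum_killKernel_eq`, if the
served outputs `τ_o(a,b,c,0)` lie in the cost-free span of a nonscalar sequence of length `≤ N'`
(for the tower: `N' = 3^{m-1}·N`, one tangent program per stage), then `R(⟨n,n,n⟩) ≤ 2N'`. -/
theorem tensorRank_le_of_jetServed {N' : ℕ} (τ : ο → MvPolynomial (GraphVars n ⊕ ι) ℂ)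
    (hspan : ∃ gs : List (MvPolynomial (GraphVars n) ℂ), IsNonscalarSeq gs ∧ gs.length ≤ N' ∧
      ∀ o, bind₁ (Sum.elim X (fun _ => 0) : GraphVars n ⊕ ι → MvPolynomial (GraphVars n) ℂ) (τ o) ∈
        freeSpan {q | q ∈ gs})
    (Q : ι → MvPolynomial (MatMulVars n) ℂ) (hQ0 : ∀ i, coeff 0 (Q i) = 0)
    (hQ1 : ∀ i (w : MatMulVars n), coeff (Finsupp.single w 1) (Q i) = 0)
    (hsec : ∀ o (i j j' l : Fin n),
      coeff (Finsupp.single (Sum.inl (i, j) : MatMulVars n) 1 +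
          Finsupp.single (Sum.inr (j', l) : MatMulVars n) 1)
        (bind₁ (Sum.elim (fun v => graphRestrict n (X v)) Q) (τ o)) = 0)
    (P : Fin n × Fin n → ο → ℂ)
    (hPc : ∀ q q' : Fin n × Fin n,
      ∑ o, P q o * coeff (Finsupp.single (Sum.inl (Sum.inr q') : GraphVars n ⊕ ι) 1) (τ o) =
        if q = q' then 1 else 0)
    (hPΛ : ∀ (q : Fin n × Fin n) (i' : ι),
      ∑ o, P q o * coeff (Finsupp.single (Sum.inr i' : GraphVars n ⊕ ι) 1) (τ o) = 0) :
    tensorRank (matMulTensor ℂ n n n) ≤ 2 * N' := by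
  classical
  refine tensorRank_le_of_abServed
    (fun o => bind₁ (Sum.elim X (fun _ => 0) : GraphVars n ⊕ ι → MvPolynomial (GraphVars n) ℂ) (τ o))
    hspan P
    (fun q => (∑ o, C (P q o) *
      bind₁ (Sum.elim X (fun _ => 0) : GraphVars n ⊕ ι → MvPolynomial (GraphVars n) ℂ) (τ o)) -
        generator n q)
    (fun q i j j' l => ?_) (fun q => by simp)
  rw [coeff_sub, coeff_ab_sum_killKernel_eq τ Q hQ0 hQ1 hsec P hPc hPΛ q i j j' l, sub_self]

end Twist

end Summit.MatrixMultiplication.MatrixMultiplication.Theorems.GraphEquations
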